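import Summits.AtomisticToContinuum.Crystallization.Theorems.ChargedEnergyGapSeamAbsorption
import HarnessLib

/-!
# `ChargedEnergyGap` — the (R2) EXCISION TERM of the rotation instances, typed: a sitewise lower bound and its weighted sum
# (cell `decomp-a2c`, lens 3, generation 62, node «SiteStressFree», part P-P; over part P-O `…Theorems.ChargedEnergyGapSeamAbsorption`)

WHY (critic row 1137 (D)(v)(b): «(R2) excision lemma typed»; memo g61 §9.5, memo g62 §1).  Under (R2) the rotation cocycle `W_{r₀,v}` has
model `0` WITHOUT excision (P-M `modelFarL_rotField_eq_zero`, P-N §N2).  WITH an excised set `X` the quadratic site term at a non-excised site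
`y` loses the bonds into `X`: `q^X_y(W) = q^∅_y(W) − ¼ Σ'_{z ∈ P ∩ X} (V′(d)/d)‖W(z − y)‖² = −¼ Σ'_{z ∈ P ∩ X} (V′(d)/d)‖W(z − y)‖²`, a DEBIT exactly
on the TENSION bonds (`V′(d) > 0`, i.e. `d > 1`: second shell outward; the compressed nearest-neighbour bonds `d = a₀ ≤ 1` are a credit).

WHAT THIS FILE PROVES (all `[this work]`, no `sorry`, no new axioms).
§P1 the summable bookkeeping: `quadSite β P X y` as an indicator sum over ALL points (`quadSite_eq_tsum_ite`), summability of the rotation bond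
  form (`summable_bondQuad_rotField`) and of the TENSION SUM INTO THE EXCISED SET `E_X(y) := Σ'_{z ∈ P ∩ X, z ≠ y} (V′(d_yz))⁺·d_yz`
  (`excisionSum`, `summable_excisionSummand`), `V′ ≤ 0` on `(0, 1]` (`ljD1_nonpos`).
§P2 ★★ THE SITEWISE EXCISION BOUND `quadSite_rotField_ge`: at a SITE-stress-free reference, for every motif site `y`, every excised set `X` and every
  rotation, `q^X_y(W_{r₀,v}) ≥ −(‖r₀‖‖v‖)²·E_X(y)` — the rotation instances' ONLY debit is the tension sum into the excised set, with the explicit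
  strain-squared prefactor (`(‖r₀‖‖v‖)² ≤ τ²/4 = 2.25·10⁻⁴` inside `SmallStrain (3/100)`); `E_∅ = 0` recovers P-M, and excising only sites at
  distance `≤ 1` from `y` is free (`excisionSum_eq_zero_of_near`).
§P3 ★★ THE WEIGHTED SUM `modelFarL_rotField_ge`: `modelFarL ϱχ D σ (W_{r₀,v}) P X λ ϱ C ≥ −λ·(‖r₀‖‖v‖)²·excisionMassL`, `excisionMassL :=
  Σ_{y ∈ motif ∖ X} χ_σ(y)·w_C(y)·E_X(y)` — the typed excision functional.  WHAT REMAINS for the critic's currency (memo g62 §1.2, [ATTACKABLE·M],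
  not attempted here): the CHARGING LEMMA `(‖r₀‖‖v‖)²·λ·excisionMassL ≤ C_H'·pricedNearCountL + c_T·shellMassL + c_χ·transMassL` on ADMISSIBLE
  geometry — near pairs (`d < 3ϱ/8`) charge the priced excised end (`≤ (τ²/4)·λ·S`, `S = sup_z Σ_{y : d < 60} (V′)⁺d ≈ 1.3`, i.e. `≈ 1.5·10⁻⁴ < C_H =
  10⁻³`), far pairs (`d ≥ 60`, summand `≤ d⁻⁶`) total `≤ 2·10⁻⁸` per unit interface area against `≥ 0.09` of shell / transition allowance per unit
  area; the scheme needs the space-filling of admissible references (no vacuum gaps in the transition bands), which is where it stops being algebra.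
-/

noncomputable section

open scoped Classical
open Literature.MathematicalPhysics.StatisticalMechanics
open Literature.Geometry.DiscreteGeometry
open Summit.AtomisticToContinuum.Crystallization.Theses.PricedLinkCensus
open Summit.AtomisticToContinuum.Crystallization.Theorems.ChargedEnergyGapNegative

namespace Summit.AtomisticToContinuum.Crystallization.Theorems.ChargedEnergyGapChartDial

/-! ## §P1 Summable bookkeeping -/

section Bookkeeping

/-- `V′ ≤ 0` on `(0, 1]` (compressed bonds: `t⁻⁷ ≤ t⁻¹³`). -/
theorem ljD1_nonpos {t : ℝ} (ht : 0 < t) (ht1 : t ≤ 1) : ljD1 t ≤ 0 := by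
  unfold ljD1
  have h1 : 1 ≤ t⁻¹ := (one_le_inv₀ ht).2 ht1
  have h2 : (t⁻¹) ^ 7 ≤ (t⁻¹) ^ 13 := pow_le_pow_right₀ h1 (by norm_num)
  linarith

/-- `|V′(t)| ≤ t⁻¹³ + t⁻⁷`. -/
theorem abs_ljD1_le (t : ℝ) (ht : 0 < t) : |ljD1 t| ≤ (t⁻¹) ^ 13 + (t⁻¹) ^ 7 := by
  unfold ljD1
  refine (abs_add_le _ _).trans ?_
  have : 0 < t⁻¹ := inv_pos.2 ht
  rw [abs_neg, abs_of_nonneg (by positivity), abs_of_nonneg (by positivity)]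

variable (β : E3 → E3 → E3) (P : PeriodicConfiguration 3) (X : Set E3) (y : E3)

/-- The quadratic site term with excised set `X` as an INDICATOR sum over all points `z ≠ y`. -/
theorem quadSite_eq_tsum_ite :
    quadSite β P X y = (1 / 4) * ∑' z : {z : E3 // z ∈ P.points ∧ z ≠ y}, if (z : E3) ∉ X then bondQuad β y (z : E3) else 0 := by
  unfold quadSite
  congr 1
  let T := {z : E3 // z ∈ P.points ∧ z ≠ y}
  let s : Set T := {z | (z : E3) ∉ X}
  let e : {z : E3 // z ∈ P.points ∧ z ∉ X ∧ z ≠ y} ≃ s :=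
    { toFun := fun z => ⟨⟨z.1, z.2.1, z.2.2.2⟩, z.2.2.1⟩
      invFun := fun z => ⟨z.1.1, z.1.2.1, z.2, z.1.2.2⟩
      left_inv := fun z => rfl
      right_inv := fun z => rfl }
  have h2 : ∑' z : {z : E3 // z ∈ P.points ∧ z ∉ X ∧ z ≠ y}, bondQuad β y (z : E3) = ∑' z : s, bondQuad β y ((z : T) : E3) := by
    rw [← e.tsum_eq]; rfl
  rw [h2, tsum_subtype s fun z : T => bondQuad β y (z : E3)]
  refine tsum_congr fun z => ?_
  simp only [Set.indicator_apply, s, Set.mem_setOf_eq]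

/-- The rotation bond form is summable over the points (three summable virial summands, P-I `summable_virial`). -/
theorem summable_bondQuad_rotField (r₀ v : E3) :
    Summable fun z : {z : E3 // z ∈ P.points ∧ z ≠ y} => bondQuad (rotField r₀ v) y (z : E3) := by
  have h1 := summable_virial P y r₀ r₀
  have h2 := summable_virial P y r₀ v
  have h3 := summable_virial P y v v
  have h := ((h1.mul_left (‖v‖ ^ 2)).sub (h2.mul_left (2 * inner ℝ v r₀))).add (h3.mul_left (‖r₀‖ ^ 2))
  refine h.congr fun z => ?_
  rw [bondQuad_rotField, norm_rotField_sq]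
  ring

/-- The **TENSION SUM INTO THE EXCISED SET** at `y`: `E_X(y) = Σ'_{z ∈ P ∩ X, z ≠ y} (V′(d_yz))⁺·d_yz` (an indicator `tsum` over all points). -/
def excisionSum : ℝ :=
  ∑' z : {z : E3 // z ∈ P.points ∧ z ≠ y}, if (z : E3) ∈ X then max (ljD1 (dist y z)) 0 * dist y (z : E3) else 0

/-- Its summand is non-negative, dominated by `d⁻¹² + d⁻⁶`, hence summable. -/
theorem excisionSummand_nonneg (z : {z : E3 // z ∈ P.points ∧ z ≠ y}) :
    0 ≤ (if (z : E3) ∈ X then max (ljD1 (dist y z)) 0 * dist y (z : E3) else 0) := by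
  split_ifs
  · exact mul_nonneg (le_max_right _ _) dist_nonneg
  · exact le_rfl

/-- `excisionSummand_le` (docstring added by the landing lane; see the module docstring). [formal bookkeeping] -/
theorem excisionSummand_le (z : {z : E3 // z ∈ P.points ∧ z ≠ y}) :
    (if (z : E3) ∈ X then max (ljD1 (dist y z)) 0 * dist y (z : E3) else 0) ≤ (dist y (z : E3))⁻¹ ^ 12 + (dist y (z : E3))⁻¹ ^ 6 := by
  have hd : 0 < dist y (z : E3) := dist_pos.2 (fun h => z.2.2 h.symm)
  set d := dist y (z : E3) with hd_def
  have hmax : max (ljD1 d) 0 ≤ d⁻¹ ^ 13 + d⁻¹ ^ 7 :=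
    max_le ((le_abs_self _).trans (abs_ljD1_le d hd)) (by positivity)
  have hid : d⁻¹ * d = 1 := inv_mul_cancel₀ hd.ne'
  have hbound : max (ljD1 d) 0 * d ≤ d⁻¹ ^ 12 + d⁻¹ ^ 6 := by
    calc max (ljD1 d) 0 * d ≤ (d⁻¹ ^ 13 + d⁻¹ ^ 7) * d := mul_le_mul_of_nonneg_right hmax hd.le
      _ = (d⁻¹ ^ 12 + d⁻¹ ^ 6) * (d⁻¹ * d) := by ring
      _ = d⁻¹ ^ 12 + d⁻¹ ^ 6 := by rw [hid, mul_one]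
  split_ifs
  · exact hbound
  · positivity

/-- `summable_excisionSummand` (docstring added by the landing lane; see the module docstring). [formal bookkeeping] -/
theorem summable_excisionSummand :
    Summable fun z : {z : E3 // z ∈ P.points ∧ z ≠ y} => if (z : E3) ∈ X then max (ljD1 (dist y z)) 0 * dist y (z : E3) else 0 :=
  Summable.of_nonneg_of_le (excisionSummand_nonneg P X y) (excisionSummand_le P X y)
    ((P.summable_inv_pow_dist (show 3 < 12 by norm_num) y).add (P.summable_inv_pow_dist (show 3 < 6 by norm_num) y))

/-- `excisionSum_nonneg` (docstring added by the landing lane; see the module docstring). [formal bookkeeping] -/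
theorem excisionSum_nonneg : 0 ≤ excisionSum P X y :=
  tsum_nonneg (excisionSummand_nonneg P X y)

/-- No excision, no tension sum (recovers P-M). -/
theorem excisionSum_empty : excisionSum P ∅ y = 0 := by
  simp [excisionSum]

/-- Excising only points at distance `≤ 1` from `y` (compressed bonds) costs `y` nothing. -/
theorem excisionSum_eq_zero_of_near (h : ∀ z ∈ P.points, z ∈ X → z ≠ y → dist y z ≤ 1) : excisionSum P X y = 0 := by
  unfold excisionSum
  rw [tsum_congr (g := fun _ => (0 : ℝ)) fun z => ?_, tsum_zero]
  split_ifs with hz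
  · have hd : 0 < dist y (z : E3) := dist_pos.2 (fun h' => z.2.2 h'.symm)
    rw [max_eq_right (ljD1_nonpos hd (h z z.2.1 hz z.2.2)), zero_mul]
  · rfl

end Bookkeeping

/-! ## §P2 ★★ The sitewise excision bound for rotation instances -/

section Sitewise

variable {P : PeriodicConfiguration 3}

/-- The pointwise comparison on an excised tension bond: `(V′/d)‖W(z − y)‖² ≤ 4(‖r₀‖‖v‖)²·(V′)⁺·d`. -/
theorem bondQuad_rotField_le (r₀ v y : E3) {z : E3} (hz : z ≠ y) :
    bondQuad (rotField r₀ v) y z ≤ 4 * (‖r₀‖ * ‖v‖) ^ 2 * (max (ljD1 (dist y z)) 0 * dist y z) := by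
  have hd : 0 < dist y z := dist_pos.2 hz.symm
  rw [bondQuad_rotField]
  have hW := norm_rotField_le r₀ v y z
  have hW0 : 0 ≤ ‖rotField r₀ v y z‖ := norm_nonneg _
  have hm : 0 ≤ max (ljD1 (dist y z)) 0 := le_max_right _ _
  calc ljD1 (dist y z) / dist y z * ‖rotField r₀ v y z‖ ^ 2
      ≤ max (ljD1 (dist y z)) 0 / dist y z * ‖rotField r₀ v y z‖ ^ 2 := by
        gcongr
        exact le_max_left _ _
    _ ≤ max (ljD1 (dist y z)) 0 / dist y z * (2 * (‖r₀‖ * ‖v‖) * dist y z) ^ 2 := by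
        gcongr
    _ = 4 * (‖r₀‖ * ‖v‖) ^ 2 * (max (ljD1 (dist y z)) 0 * dist y z) * (dist y z / dist y z) := by ring
    _ = 4 * (‖r₀‖ * ‖v‖) ^ 2 * (max (ljD1 (dist y z)) 0 * dist y z) := by rw [div_self hd.ne', mul_one]

/-- ★★ **THE SITEWISE EXCISION BOUND.**  At a SITE-stress-free reference, for every motif site `y`, every excised set `X` and every rotation
cocycle, `q^X_y(W_{r₀,v}) ≥ −(‖r₀‖‖v‖)²·E_X(y)`: the full-point sum vanishes (P-M), the excised part is a sum over tension bonds into `X`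
bounded by the strain-squared times the tension sum. -/
theorem quadSite_rotField_ge (hS : IsSiteStressFree P) {y : E3} (hy : y ∈ P.motif) (X : Set E3) (r₀ v : E3) :
    -((‖r₀‖ * ‖v‖) ^ 2 * excisionSum P X y) ≤ quadSite (rotField r₀ v) P X y := by
  set f : {z : E3 // z ∈ P.points ∧ z ≠ y} → ℝ := fun z => bondQuad (rotField r₀ v) y (z : E3) with hf_def
  have hf : Summable f := summable_bondQuad_rotField P y r₀ v
  -- the full sum vanishes
  have h0 : ∑' z, f z = 0 := by
    have h := quadSite_rotField_eq_zero hS hy r₀ v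
    rw [quadSite_empty_eq] at h
    have : (1 / 4 : ℝ) * ∑' z, f z = 0 := h
    linarith
  -- the excised part
  let s : Set {z : E3 // z ∈ P.points ∧ z ≠ y} := {z | (z : E3) ∈ X}
  have hfX : Summable fun z : {z : E3 // z ∈ P.points ∧ z ≠ y} => if (z : E3) ∈ X then f z else 0 :=
    (hf.indicator s).congr fun z => by simp only [Set.indicator_apply, s, Set.mem_setOf_eq]
  have hsplit : ∑' z : {z : E3 // z ∈ P.points ∧ z ≠ y}, (if (z : E3) ∉ X then f z else 0) =
      ∑' z, f z - ∑' z : {z : E3 // z ∈ P.points ∧ z ≠ y}, (if (z : E3) ∈ X then f z else 0) := by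
    rw [← hf.tsum_sub hfX]
    refine tsum_congr fun z => ?_
    split_ifs <;> simp
  have hg := summable_excisionSummand P X y
  have hbound : ∑' z : {z : E3 // z ∈ P.points ∧ z ≠ y}, (if (z : E3) ∈ X then f z else 0) ≤
      ∑' z : {z : E3 // z ∈ P.points ∧ z ≠ y}, 4 * (‖r₀‖ * ‖v‖) ^ 2 *
        (if (z : E3) ∈ X then max (ljD1 (dist y z)) 0 * dist y (z : E3) else 0) := by
    refine hfX.tsum_le_tsum (fun z => ?_) (hg.mul_left _)
    split_ifs
    · exact bondQuad_rotField_le r₀ v y z.2.2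
    · simp
  rw [tsum_mul_left] at hbound
  have hq : quadSite (rotField r₀ v) P X y =
      (1 / 4) * ∑' z : {z : E3 // z ∈ P.points ∧ z ≠ y}, (if (z : E3) ∉ X then f z else 0) := quadSite_eq_tsum_ite _ P X y
  rw [hq, hsplit, h0]
  unfold excisionSum
  linarith

/-- Consistency with P-M: at `X = ∅` the bound reads `0 ≤ q^∅_y(W) (= 0)`. -/
theorem quadSite_rotField_ge_empty (hS : IsSiteStressFree P) {y : E3} (hy : y ∈ P.motif) (r₀ v : E3) :
    (0 : ℝ) ≤ quadSite (rotField r₀ v) P ∅ y := by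
  have h := quadSite_rotField_ge hS hy ∅ r₀ v
  rwa [excisionSum_empty, mul_zero, neg_zero] at h

end Sitewise

/-! ## §P3 ★★ The weighted sum: the typed excision functional bounds the localised model of every rotation instance -/

section Weighted

variable (ϱχ : ℝ) {m : ℕ} (D : Fin m → Set E3) (σ : Fin m → Bool) (P : PeriodicConfiguration 3) (X : Set E3) (ϱ : ℝ) (C : Set E3)

/-- The **LOCALISED EXCISION MASS** `Σ_{y ∈ motif ∖ X} χ_σ(y)·w_C(y)·E_X(y)` — the tension sums into the excised set, weighted like the model. -/
def excisionMassL : ℝ :=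
  ∑ y ∈ P.motif, if y ∈ X then 0 else localFactor ϱχ D σ y * (profileWeight ϱ C y * excisionSum P X y)

/-- `excisionMassL_nonneg` (docstring added by the landing lane; see the module docstring). [formal bookkeeping] -/
theorem excisionMassL_nonneg : 0 ≤ excisionMassL ϱχ D σ P X ϱ C :=
  Finset.sum_nonneg fun y _ => by
    split_ifs
    · exact le_rfl
    · exact mul_nonneg (localFactor_nonneg (ϱχ := ϱχ) (D := D) (σ := σ) y)
        (mul_nonneg (profileWeight_nonneg ϱ C y) (excisionSum_nonneg P X y))

/-- Without excision the excision mass vanishes. -/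
theorem excisionMassL_empty : excisionMassL ϱχ D σ P ∅ ϱ C = 0 := by
  simp [excisionMassL, excisionSum_empty]

variable {P}

/-- ★★ **THE TYPED EXCISION FUNCTIONAL BOUNDS THE ROTATION INSTANCES**: at a SITE-stress-free reference, for every centre set, excised set,
localisation and rotation, `modelFarL ϱχ D σ (W_{r₀,v}) P X λ ϱ C ≥ −λ·(‖r₀‖‖v‖)²·excisionMassL` (`λ ≥ 0`).  With `SmallStrain (3/100)` forcing
`‖r₀‖‖v‖ ≤ 3/200` on realised bonds and `λ = 1/2`, the prefactor is `≤ 1.125·10⁻⁴`. -/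
theorem modelFarL_rotField_ge (hS : IsSiteStressFree P) {lamQ : ℝ} (hlam : 0 ≤ lamQ) (r₀ v : E3) :
    -(lamQ * (‖r₀‖ * ‖v‖) ^ 2 * excisionMassL ϱχ D σ P X ϱ C) ≤ modelFarL ϱχ D σ (rotField r₀ v) P X lamQ ϱ C := by
  unfold modelFarL excisionMassL
  rw [Finset.mul_sum, ← Finset.sum_neg_distrib]
  refine Finset.sum_le_sum fun y hy => ?_
  split_ifs with hyX
  · simp
  · rw [linSite_rotField, zero_add]
    have hq := quadSite_rotField_ge hS hy X r₀ v
    have hlf := localFactor_nonneg (ϱχ := ϱχ) (D := D) (σ := σ) y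
    have hpw := profileWeight_nonneg ϱ C y
    have h1 : lamQ * (-((‖r₀‖ * ‖v‖) ^ 2 * excisionSum P X y)) ≤ lamQ * quadSite (rotField r₀ v) P X y :=
      mul_le_mul_of_nonneg_left hq hlam
    have h2 := mul_le_mul_of_nonneg_left (mul_le_mul_of_nonneg_left h1 hpw) hlf
    have e : -(lamQ * (‖r₀‖ * ‖v‖) ^ 2 * (localFactor ϱχ D σ y * (profileWeight ϱ C y * excisionSum P X y))) =
        localFactor ϱχ D σ y * (profileWeight ϱ C y * (lamQ * (-((‖r₀‖ * ‖v‖) ^ 2 * excisionSum P X y)))) := by ring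
    rw [e]
    exact h2

/-- ★ Hence the conclusion of (H𝄪ˢ) for a rotation instance WITH excision holds as soon as the allowances cover the excision functional:
`λ(‖r₀‖‖v‖)²·excisionMassL ≤ C_T·shellMassL + Cχ·transMassL + C_H·pricedNearCountL` — the CHARGING inequality that remains (file header). -/
theorem localS_conclusion_rotField_of_charging (hS : IsSiteStressFree P) {lamQ : ℝ} (hlam : 0 ≤ lamQ) {C_T Cχ C_H : ℝ} (r₀ v : E3)
    (S : Fin 0 → CutPiece)
    (hch : lamQ * (‖r₀‖ * ‖v‖) ^ 2 * excisionMassL ϱχ D σ P X ϱ C ≤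
      C_T * shellMassL ϱχ D σ P X ϱ C + Cχ * transMassL ϱχ D σ P X ϱ C + C_H * (pricedNearCountL ϱχ D σ P X ϱ C : ℝ)) :
    -(C_T * shellMassL ϱχ D σ P X ϱ C) - Cχ * transMassL ϱχ D σ P X ϱ C - C_H * (pricedNearCountL ϱχ D σ P X ϱ C : ℝ) ≤
      modelFarL ϱχ D σ (volterraField P S (rotField r₀ v)) P X lamQ ϱ C := by
  rw [volterraField_fin_zero]
  have h := modelFarL_rotField_ge ϱχ D σ X ϱ C hS hlam r₀ v
  linarith

/-- Record numerals of the charging estimate (memo g62 §1.2; inputs: `τ = 3/100`, `λ = 1/2`, near tension constant `S ≤ 1.3`, far tail `2·10⁻⁸`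
vs `0.09` per unit area): the near charge per priced site `(τ²/4)·λ·S < 1.5·10⁻⁴ < C_H = 10⁻³`, the far tail ratio `< 10⁻⁶`. -/
theorem record_excision_charging : ((3 / 100 : ℝ) ^ 2 / 4) * (1 / 2) * (13 / 10) < 15 / 100000 ∧ (15 / 100000 : ℝ) < 1 / 1000 ∧
    (2 / 100000000 : ℝ) / (9 / 100) < 1 / 1000000 := by
  refine ⟨by norm_num, by norm_num, by norm_num⟩

end Weighted

end Summit.AtomisticToContinuum.Crystallization.Theorems.ChargedEnergyGapChartDial

end
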